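import Literature.AlgebraicGeometry.Resolution.BlowupStrictTransform
import Mathlib.RingTheory.Localization.BaseChange
import Mathlib.RingTheory.RingHom.Flat
import Mathlib.RingTheory.Flat.Basic
import HarnessLib

/-!
# Affine blowup algebras commute with flat base change: `B ⊗_A A[I/a] ≅ B[IB/a]`

Topic: `Literature/AlgebraicGeometry/Resolution`. For a ring map `A → B`, an ideal `I ⊆ A`, an
element `a ∈ A` and an ideal `J` of `B` with `I·B = J`, the map of affine blowup algebras
`ψ : A[I/a] → B[J/a]` (`blowupAlgebraMap`, `BlowupStrictTransform.lean`; the image model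
`A[I/a] ⊆ A[1/a]` of `AffineBlowupAlgebra.lean`, Stacks 052Q / Görtz–Wedhorn (13.19)) exhibits
`B[J/a]` as the BASE CHANGE `B ⊗_A A[I/a]` as soon as `B` is flat over `A` — the affine form of
"blowing up commutes with flat base change" (Stacks, Tag 0805; Görtz–Wedhorn I, Prop. 13.91 (2)).
The special case with a quotient built in (`A → Ah`, `(A/I)[J/t]`) is `chartBaseChangeEquiv` of
`FormalBranchesChart.lean`; here the plain case is recorded in the forms consumed downstream:

* `exists_baseChange_linearEquiv` — a `B`-linear isomorphism `e : B ⊗_A A[I/a] ≅ B[J/a]` with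
  `e (y ⊗ r) = y · ψ(r)`. Proof (Stacks 0805): the comparison map `Θ : y ⊗ r ↦ y · r` into
  `B[1/a]` is the restriction of Mathlib's isomorphism `B ⊗_A A[1/a] ≅ B[1/a]`
  (`IsLocalization.tensor`; private `exists_locTensorEquiv`) along `B ⊗ (A[I/a] ↪ A[1/a])`,
  injective by flatness; its range is `B[J/a]` (generators `φ(x)/a = Θ(1 ⊗ x/a)`).
* `span_range_blowupAlgebraMap` — `B[J/a]` is the `B`-span of `ψ(A[I/a])`.
* `flat_blowupAlgebraMap` — hence **`ψ : A[I/a] → B[J/a]` is flat** (`RingHom.Flat`): the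
  square `A → B`, `A[I/a] → B[J/a]` is a pushout of rings (`Algebra.IsPushout`, for the algebra
  structure `ψ.toAlgebra`), i.e. `ψ` is a base change of the flat `A → B`.
* `exists_sub_mem_map_of_forall` — APPROXIMATION: if every `b ∈ B` is `φ(a₀) + w` with `w` in an
  ideal `𝔞 ⊆ B`, then every element of `B[J/a]` is `ψ(r) + w'` with `w' ∈ 𝔞·B[J/a]` (e.g.
  `𝔞 = 𝔪_B^m` for an `𝔪`-adically dense `A → B`).

Everything is PROVED; no definitions, no named facts.

## Sources

* The Stacks Project, Tag 0805 (blowing up commutes with flat base change), Tag 052Q (affine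
  blowup algebras). [StacksProject]
* U. Görtz, T. Wedhorn, *Algebraic Geometry I: Schemes*, 2nd ed., Springer 2020, Prop. 13.91 (2),
  (13.19) p. 415. [GortzWedhorn2020]
-/

noncomputable section

open TensorProduct IsLocalization

namespace Literature.AlgebraicGeometry.Resolution

universe u

namespace BlowupAlgebraFlatBaseChange

variable {A B : Type u} [CommRing A] [CommRing B] [Algebra A B] (I : Ideal A) (J : Ideal B) (a : A)

/-- `A[1/a] → B[1/a]` is compatible with the `A`-algebra structures. [folklore] -/
private theorem awayMap_algebraMap_base (x : A) :
    Localization.awayMap (algebraMap A B) a (algebraMap A (Localization.Away a) x) =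
      algebraMap A (Localization.Away (algebraMap A B a)) x := by
  rw [awayMap_algebraMap, ← IsScalarTower.algebraMap_apply]

/-- **`B ⊗_A A[1/a] ≅ B[1/a]`, `y ⊗ z ↦ y · z`** (localization commutes with base change,
Mathlib `IsLocalization.tensor`), in the form: a `B`-algebra isomorphism whose value on `y ⊗ z`
is `y · awayMap z` (private plumbing for `exists_baseChange_linearEquiv`). [folklore] -/
private theorem exists_locTensorEquiv :
    ∃ e : B ⊗[A] Localization.Away a ≃ₐ[B] Localization.Away (algebraMap A B a),
      ∀ (y : B) (z : Localization.Away a),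
        e (y ⊗ₜ z) = algebraMap B _ y * Localization.awayMap (algebraMap A B) a z := by
  haveI : IsLocalization.Away (algebraMap A B a) (B ⊗[A] Localization.Away a) := by
    rw [IsLocalization.Away, ← Algebra.algebraMapSubmonoid_powers]
    exact IsLocalization.tensor (Localization.Away a) (Submonoid.powers a)
  let e : B ⊗[A] Localization.Away a ≃ₐ[B] Localization.Away (algebraMap A B a) :=
    IsLocalization.algEquiv (Submonoid.powers (algebraMap A B a)) _ _
  -- `e (1 ⊗ z) = awayMap z`: two ring maps `A[1/a] → B[1/a]` agreeing on `A`
  have h1 : ∀ z : Localization.Away a, e (1 ⊗ₜ z) = Localization.awayMap (algebraMap A B) a z := by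
    intro z
    let f₁ : Localization.Away a →+* Localization.Away (algebraMap A B a) :=
      e.toAlgHom.toRingHom.comp (Algebra.TensorProduct.includeRight (R := A) (A := B)).toRingHom
    suffices h : f₁ = Localization.awayMap (algebraMap A B) a from
      congrArg (fun f : Localization.Away a →+* Localization.Away (algebraMap A B a) => f z) h
    refine IsLocalization.ringHom_ext (Submonoid.powers a) (RingHom.ext fun x => ?_)
    change e (1 ⊗ₜ algebraMap A (Localization.Away a) x) = Localization.awayMap (algebraMap A B) a
      (algebraMap A (Localization.Away a) x)
    rw [awayMap_algebraMap, Algebra.algebraMap_eq_smul_one (A := Localization.Away a) x,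
      TensorProduct.tmul_smul, ← Algebra.TensorProduct.one_def,
      ← Algebra.algebraMap_eq_smul_one (A := B ⊗[A] Localization.Away a) x,
      IsScalarTower.algebraMap_apply A B (B ⊗[A] Localization.Away a), AlgEquiv.commutes]
  refine ⟨e, fun y z => ?_⟩
  have hmul : (y ⊗ₜ[A] z : B ⊗[A] Localization.Away a) = (y ⊗ₜ 1) * (1 ⊗ₜ z) := by
    rw [Algebra.TensorProduct.tmul_mul_tmul, mul_one, one_mul]
  have hy : (y ⊗ₜ[A] (1 : Localization.Away a) : B ⊗[A] Localization.Away a) =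
      algebraMap B (B ⊗[A] Localization.Away a) y := by
    rw [Algebra.TensorProduct.algebraMap_apply, Algebra.algebraMap_self, RingHom.id_apply]
  rw [hmul, map_mul, h1, hy, AlgEquiv.commutes]

variable (hIJ : I.map (algebraMap A B) ≤ J)

/-- **Affine blowup algebras commute with flat base change** (Stacks 0805 on the chart `D₊(at)`):
for `B` flat over `A` and `J = I·B`, there is a `B`-linear isomorphism
`e : B ⊗_A A[I/a] ≅ B[J/a]` with `e (y ⊗ r) = y · ψ(r)`, `ψ = blowupAlgebraMap : A[I/a] → B[J/a]`.
Injectivity: `Θ : y ⊗ r ↦ y · r ∈ B[1/a]` is `B ⊗_A A[1/a] ≅ B[1/a]` after the injection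
`B ⊗ (A[I/a] ↪ A[1/a])` (flatness); surjectivity: the generators `x'/a`, `x' ∈ J = I·B`, are
`B`-combinations of the `Θ(1 ⊗ x/a)`, `x ∈ I`. [cite: StacksProject, Tag 0805] -/
theorem exists_baseChange_linearEquiv [Module.Flat A B] (hJI : J ≤ I.map (algebraMap A B)) :
    ∃ e : B ⊗[A] blowupAlgebra I a ≃ₗ[B] blowupAlgebra J (algebraMap A B a),
      ∀ (y : B) (r : blowupAlgebra I a),
        e (y ⊗ₜ r) = y • blowupAlgebraMap (algebraMap A B) I J a hIJ r := by
  set L := Localization.Away a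
  set L' := Localization.Away (algebraMap A B a)
  set R := blowupAlgebra I a
  set R' := blowupAlgebra J (algebraMap A B a)
  set ψ := blowupAlgebraMap (algebraMap A B) I J a hIJ
  -- `awayMap` as an `A`-algebra map and the comparison map `Θ : B ⊗_A R → L'`
  let μ : L →ₐ[A] L' :=
    { toRingHom := Localization.awayMap (algebraMap A B) a, commutes' := awayMap_algebraMap_base a }
  let Θ : B ⊗[A] R →ₐ[B] L' :=
    Algebra.TensorProduct.lift (Algebra.ofId B L') (μ.comp (R.val.restrictScalars A))
      fun _ _ => Commute.all _ _
  have hΘ : ∀ (y : B) (r : R), Θ (y ⊗ₜ r) = algebraMap B L' y * Localization.awayMap (algebraMap A B) a r :=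
    fun y r => Algebra.TensorProduct.lift_tmul _ _ _ y r
  -- `Θ = Θ̃ ∘ (B ⊗ incl)` with `Θ̃ : B ⊗_A L ≅ L'`
  obtain ⟨Θt, hΘt⟩ := exists_locTensorEquiv (A := A) (B := B) a
  have hfac : ∀ t : B ⊗[A] R,
      Θ t = Θt (LinearMap.lTensor B (R.val.restrictScalars A).toLinearMap t) := by
    intro t
    induction t using TensorProduct.induction_on with
    | zero => rw [map_zero, map_zero, map_zero]
    | tmul y r => rw [hΘ, LinearMap.lTensor_tmul, AlgHom.toLinearMap_apply, hΘt]; rfl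
    | add t₁ t₂ h₁ h₂ => rw [map_add, h₁, h₂, map_add, map_add]
  have hinj : Function.Injective Θ := by
    have hval : Function.Injective (LinearMap.lTensor B (R.val.restrictScalars A).toLinearMap) :=
      Module.Flat.lTensor_preserves_injective_linearMap _ Subtype.val_injective
    intro t₁ t₂ h
    rw [hfac, hfac] at h
    exact hval (Θt.injective h)
  -- the range of `Θ` is `R'`
  have hmem : ∀ t : B ⊗[A] R, Θ t ∈ R' := by
    intro t
    induction t using TensorProduct.induction_on with
    | zero => rw [map_zero]; exact Subalgebra.zero_mem _
    | tmul y r =>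
      rw [hΘ]
      exact Subalgebra.mul_mem _ (Subalgebra.algebraMap_mem _ _)
        (awayMap_mem_blowupAlgebra (algebraMap A B) I J a hIJ r.2)
    | add t₁ t₂ h₁ h₂ => rw [map_add]; exact Subalgebra.add_mem _ h₁ h₂
  have hsurj : ∀ x : L', x ∈ R' → ∃ t : B ⊗[A] R, Θ t = x := by
    -- the range is a `B`-subalgebra of `L'` containing the generators `x'/a`, `x' ∈ J`
    let T : Subalgebra B L' :=
      { carrier := Set.range Θ
        mul_mem' := by
          rintro _ _ ⟨t₁, rfl⟩ ⟨t₂, rfl⟩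
          exact ⟨t₁ * t₂, map_mul _ _ _⟩
        one_mem' := ⟨1, map_one _⟩
        add_mem' := by
          rintro _ _ ⟨t₁, rfl⟩ ⟨t₂, rfl⟩
          exact ⟨t₁ + t₂, map_add _ _ _⟩
        zero_mem' := ⟨0, map_zero _⟩
        algebraMap_mem' := fun y => ⟨y ⊗ₜ 1, by
          rw [hΘ, OneMemClass.coe_one, map_one, mul_one]⟩ }
    suffices h : R' ≤ T from fun x hx => h hx
    refine Algebra.adjoin_le ?_
    rintro _ ⟨w, hw, rfl⟩
    change _ ∈ Set.range Θ
    have hw' : w ∈ I.map (algebraMap A B) := hJI hw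
    clear hw
    rw [Ideal.map] at hw'
    induction hw' using Submodule.span_induction with
    | mem w hw =>
      obtain ⟨x, hx, rfl⟩ := hw
      refine ⟨1 ⊗ₜ ⟨_, div_mem_blowupAlgebra I a hx⟩, ?_⟩
      rw [hΘ, map_one, one_mul, Subtype.coe_mk, map_mul, awayMap_algebraMap, awayMap_invSelf]
    | zero => exact ⟨0, by rw [map_zero, map_zero, zero_mul]⟩
    | add w₁ w₂ _ _ h₁ h₂ =>
      obtain ⟨t₁, ht₁⟩ := h₁
      obtain ⟨t₂, ht₂⟩ := h₂
      exact ⟨t₁ + t₂, by rw [map_add, ht₁, ht₂, map_add, add_mul]⟩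
    | smul y w _ h =>
      obtain ⟨t, ht⟩ := h
      refine ⟨y • t, ?_⟩
      rw [map_smul, ht, smul_eq_mul, map_mul, Algebra.smul_def, mul_assoc]
  -- assemble the equivalence
  let Θ' : B ⊗[A] R →ₐ[B] R' := Θ.codRestrict R' hmem
  have hbij : Function.Bijective Θ' := by
    refine ⟨fun t₁ t₂ h => hinj (congrArg Subtype.val h), fun x => ?_⟩
    obtain ⟨t, ht⟩ := hsurj x x.2
    exact ⟨t, Subtype.ext ht⟩
  refine ⟨(AlgEquiv.ofBijective Θ' hbij).toLinearEquiv, fun y r => Subtype.ext ?_⟩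
  change Θ (y ⊗ₜ r) = ((y • ψ r : R') : L')
  rw [hΘ, Subalgebra.coe_smul, Algebra.smul_def, coe_blowupAlgebraMap]

/-- **The map of affine blowup algebras `ψ : A[I/a] → B[J/a]` is FLAT** for `B` flat over `A` and
`J = I·B` (base change of a flat ring map, Stacks 0805 + Mathlib
`RingHom.Flat.isStableUnderBaseChange`: the square `A → B`, `A[I/a] → B[J/a]` is a pushout of
rings, `Algebra.IsPushout`, by `exists_baseChange_linearEquiv`). [cite: StacksProject, Tag 0805] -/
theorem flat_blowupAlgebraMap [Module.Flat A B] (hJI : J ≤ I.map (algebraMap A B)) :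
    (blowupAlgebraMap (algebraMap A B) I J a hIJ).Flat := by
  letI := (blowupAlgebraMap (algebraMap A B) I J a hIJ).toAlgebra
  haveI : IsScalarTower A (blowupAlgebra I a) (blowupAlgebra J (algebraMap A B a)) :=
    IsScalarTower.of_algebraMap_eq fun x => by
      rw [RingHom.algebraMap_toAlgebra, blowupAlgebraMap_algebraMap,
        ← IsScalarTower.algebraMap_apply]
  -- the square `A → B`, `A[I/a] → B[J/a]` is a pushout (`B[J/a] = B ⊗_A A[I/a]`)
  haveI : Algebra.IsPushout A B (blowupAlgebra I a) (blowupAlgebra J (algebraMap A B a)) := by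
    obtain ⟨e, he⟩ := exists_baseChange_linearEquiv I J a hIJ hJI
    refine ⟨IsBaseChange.of_equiv e fun r => ?_⟩
    rw [he, one_smul]
    rfl
  exact RingHom.Flat.isStableUnderBaseChange A B (blowupAlgebra I a) (blowupAlgebra J (algebraMap A B a))
    (RingHom.flat_algebraMap_iff.mpr inferInstance)

/-- **Approximation**: if every element of `B` is `φ(a₀) + w` with `w` in an ideal `𝔞` (e.g.
`𝔞 = 𝔪_B^m` along an `𝔪`-adically dense local map), then every element of `B[J/a]` is
`ψ(r) + w'` with `r ∈ A[I/a]` and `w' ∈ 𝔞·B[J/a]` (`B` flat over `A`, `J = I·B`) — the identity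
`B[J/a] = B ⊗_A A[I/a]` of Stacks 0805 read on elements. [cite: StacksProject, Tag 0805] -/
theorem exists_sub_mem_map_of_forall [Module.Flat A B] (hJI : J ≤ I.map (algebraMap A B))
    (𝔞 : Ideal B) (h𝔞 : ∀ b : B, ∃ a₀ : A, b - algebraMap A B a₀ ∈ 𝔞)
    (x : blowupAlgebra J (algebraMap A B a)) :
    ∃ r : blowupAlgebra I a, x - blowupAlgebraMap (algebraMap A B) I J a hIJ r ∈
      𝔞.map (algebraMap B (blowupAlgebra J (algebraMap A B a))) := by
  obtain ⟨e, he⟩ := exists_baseChange_linearEquiv I J a hIJ hJI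
  suffices h : ∀ t : B ⊗[A] blowupAlgebra I a, ∃ r : blowupAlgebra I a,
      e t - blowupAlgebraMap (algebraMap A B) I J a hIJ r ∈
        𝔞.map (algebraMap B (blowupAlgebra J (algebraMap A B a))) by
    obtain ⟨r, hr⟩ := h (e.symm x)
    exact ⟨r, by rwa [e.apply_symm_apply] at hr⟩
  intro t
  induction t using TensorProduct.induction_on with
  | zero => exact ⟨0, by rw [map_zero, map_zero, sub_zero]; exact zero_mem _⟩
  | tmul y r₀ =>
    obtain ⟨a₀, ha₀⟩ := h𝔞 y
    refine ⟨algebraMap A (blowupAlgebra I a) a₀ * r₀, ?_⟩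
    have : e (y ⊗ₜ r₀) - blowupAlgebraMap (algebraMap A B) I J a hIJ (algebraMap A (blowupAlgebra I a) a₀ * r₀) =
        algebraMap B (blowupAlgebra J (algebraMap A B a)) (y - algebraMap A B a₀) *
          blowupAlgebraMap (algebraMap A B) I J a hIJ r₀ := by
      rw [he, map_mul, blowupAlgebraMap_algebraMap, Algebra.smul_def, map_sub, sub_mul]
    rw [this]
    exact Ideal.mul_mem_right _ _ (Ideal.mem_map_of_mem _ ha₀)
  | add t₁ t₂ h₁ h₂ =>
    obtain ⟨r₁, hr₁⟩ := h₁
    obtain ⟨r₂, hr₂⟩ := h₂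
    refine ⟨r₁ + r₂, ?_⟩
    have : e (t₁ + t₂) - blowupAlgebraMap (algebraMap A B) I J a hIJ (r₁ + r₂) =
        (e t₁ - blowupAlgebraMap (algebraMap A B) I J a hIJ r₁) +
          (e t₂ - blowupAlgebraMap (algebraMap A B) I J a hIJ r₂) := by
      rw [map_add, map_add]; ring
    rw [this]
    exact add_mem hr₁ hr₂

/-- **`B[J/a]` is generated by `ψ(A[I/a])` as a `B`-module** (`B` flat over `A`, `J = I·B`):
surjectivity of `B ⊗_A A[I/a] → B[J/a]` (Stacks 0805). [cite: StacksProject, Tag 0805] -/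
theorem span_range_blowupAlgebraMap [Module.Flat A B] (hJI : J ≤ I.map (algebraMap A B)) :
    Submodule.span B (Set.range (blowupAlgebraMap (algebraMap A B) I J a hIJ)) = ⊤ := by
  obtain ⟨e, he⟩ := exists_baseChange_linearEquiv I J a hIJ hJI
  rw [eq_top_iff]
  rintro x -
  obtain ⟨t, rfl⟩ := e.surjective x
  induction t using TensorProduct.induction_on with
  | zero => rw [map_zero]; exact zero_mem _
  | tmul y r => rw [he]; exact Submodule.smul_mem _ _ (Submodule.subset_span ⟨r, rfl⟩)
  | add t₁ t₂ h₁ h₂ => rw [map_add]; exact add_mem h₁ h₂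

end BlowupAlgebraFlatBaseChange

end Literature.AlgebraicGeometry.Resolution

end
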